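import Summits.QuantumFields.YangMills.Theses.ConvexGribovBody
import Literature.MathematicalPhysics.QuantumFieldTheory.LatticeGaugeProofs

/-!
# Spatial susceptibility bound from the slice Poincaré inequality
(crux `ConvexGribovBody.PoincareToGap`, line `Sketch`, stub F1)

Torus `(ℤ/(2S+1))⁴`, time = coordinate `0`, Wilson state `μ = wilsonMeasure r.ρ β`, translations
`T_y := torusConfigShift (Pi.single 1 y)` in the spatial direction `1`,
`(T_y U)(x, i) = U(x - y e₁, i)`.

`stub_sliceCovSum_le`: IF the crux hypothesis holds on this torus — the Poincaré inequality
`Var_μ f ≤ κ · dir f`, `dir f = Σ_{e : t = 0, spatial} ∫ (slope_e f)² dμ`, for every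
gauge-invariant link-Lipschitz `f` reading only time-zero spatial links — then for every bounded
measurable gauge-invariant link-Lipschitz observable `A` of the layer `{t = 0, x₁ = 0}` (spatial
links) and `0 ≤ κ`, `Σ_{y ∈ ℤ/(2S+1)} Cov_μ(A, A ∘ T_y) ≤ κ · dir A`.

Proof.  Apply the hypothesis to the translate sum `f := Σ_y A ∘ T_y`.  It is admissible:
translations commute with gauge transformations (`shift_gaugeTransform`), `A ∘ T_y` reads the
layer `x₁ = -y` of time-zero spatial links, and the Lipschitz seminorm is translation invariant
(re-indexing of the edge sum), so `f` is Lipschitz with constant `(2S+1) K`.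
* VARIANCE: by translation invariance of `μ` (`wilsonMeasure_map_torusConfigShift`)
  `∫ (A∘T_y)(A∘T_{y'}) dμ = ∫ A · (A∘T_{y'-y}) dμ`, hence `Var f = (2S+1) Σ_z Cov(A, A∘T_z)`
  (`var_sum_eq`: expansion of the square of the sum, re-indexing `y' ↦ y' - y`).
* DIRICHLET FORM: a link `e` is read by exactly one translate, `y₀ = -x₁(e)`, and
  `T_{y₀}(update U e g) = update (T_{y₀} U) ê g` with `ê = (e.1 + y₀ e₁, e.2)` in the layer and
  `(T_{y₀} U) ê = U e` (`translateSum_update_sub`, `shift_update`); so the difference functions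
  `g ↦ f(update U e g) - f U` and `g ↦ A(update V ê g) - A V`, `V = T_{y₀} U`, coincide, whence
  `slope_e f (U) = slope_ê A (T_{y₀} U)` and, integrating with translation invariance,
  `∫ (slope_e f)² dμ = ∫ (slope_ê A)² dμ`.  The map `e ↦ ê` is `(2S+1)`-to-one from the
  time-zero spatial links onto those of the layer, so
  `dir f = (2S+1) Σ_{ê ∈ layer} ∫ (slope_ê A)² ≤ (2S+1) dir A`
  (`sum_slice_shift_le`; the omitted terms are integrals of squares).
Dividing `(2S+1) Σ_z Cov(A, A∘T_z) = Var f ≤ κ dir f ≤ (2S+1) κ dir A` by `2S+1` gives the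
claim.  The main lemma `sliceCovSum_le_of_poincare` is stated for an arbitrary probability
measure invariant under the `T_y`, an arbitrary translation-invariant Lipschitz gauge `Λ`, and an
arbitrary "slope" functional `sl f U e` depending on `(f, U, e)` only through the difference
function `g ↦ f(update U e g) - f U` and the value `U e` (the metric slope of the crux is such a
functional).

References: folklore (translation invariance; additivity of Dirichlet forms over disjoint blocks
of variables; the susceptibility as a sum of covariances of translates, e.g. B. Simon,
*The Statistical Mechanics of Lattice Gases* I (1993), §II.5).
-/

noncomputable section

open scoped BigOperators Topology
open MeasureTheory Filter
open Literature.MathematicalPhysics.QuantumFieldTheory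

namespace Summit.QuantumFields.YangMills.Theorems.PoincareToGap

/-! ### Torus translations: composition, single-link updates, gauge covariance -/

section Shifts

variable {d L : ℕ} {G : Type*} [MeasurableSpace G]

/-- Composition of torus translations: `T_v (T_w U) = T_{v+w} U`. -/
private theorem shift_shift (v w : Site d L) (U : GaugeConfig d L G) :
    torusConfigShift v (torusConfigShift w U) = torusConfigShift (v + w) U := by
  funext e
  simp only [torusConfigShift_apply, sub_sub]

/-- Translating a configuration updated at the link `e` is updating the translated configuration
at the translated link `(e.1 + v, e.2)`. -/
private theorem shift_update (v : Site d L) (U : GaugeConfig d L G) (e : Edge d L) (g : G) :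
    torusConfigShift v (Function.update U e g) =
      Function.update (torusConfigShift v U) (e.1 + v, e.2) g := by
  funext e'
  rw [torusConfigShift_apply]
  by_cases h : e' = (e.1 + v, e.2)
  · subst h
    simp
  · rw [Function.update_of_ne h, torusConfigShift_apply, Function.update_of_ne]
    rintro rfl
    exact h (by simp)

/-- Translations commute with gauge transformations up to translating the gauge function. -/
private theorem shift_gaugeTransform [Group G] (v : Site d L) (g : Site d L → G)
    (U : GaugeConfig d L G) :
    torusConfigShift v (gaugeTransform g U) =
      gaugeTransform (fun x => g (x - v)) (torusConfigShift v U) := by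
  funext e
  simp only [torusConfigShift_apply, gaugeTransform, Site.shift, sub_add_eq_add_sub]

end Shifts

/-! ### Two elementary identities on a probability space -/

/-- On a probability space, `∫ (f - ∫ f)² = ∫ f² - (∫ f)²` for `f ∈ L²`. -/
private theorem integral_sub_average_sq {Ω : Type*} [MeasurableSpace Ω] {μ : Measure Ω}
    [IsProbabilityMeasure μ] {f : Ω → ℝ} (hf : MemLp f 2 μ) :
    ∫ x, (f x - ∫ y, f y ∂μ) ^ 2 ∂μ = ∫ x, f x ^ 2 ∂μ - (∫ y, f y ∂μ) ^ 2 := by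
  set c := ∫ y, f y ∂μ with hc
  have hi : Integrable f μ := hf.integrable one_le_two
  have e : ∀ x, (f x - c) ^ 2 = (f x ^ 2 - (2 * c) * f x) + c ^ 2 := fun x => by ring
  have i1 : Integrable (fun x => f x ^ 2 - (2 * c) * f x) μ :=
    hf.integrable_sq.sub (hi.const_mul _)
  simp_rw [e]
  rw [integral_add i1 (integrable_const _), integral_sub hf.integrable_sq (hi.const_mul _),
    integral_const_mul, integral_const, probReal_univ, one_smul, ← hc]
  ring

/-- Variance of a sum of bounded variables indexed by a finite additive group with stationary
correlations: if `∫ B_i = m` and `∫ B_i B_j = F (j - i)`, then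
`Var(Σ_i B_i) = |ι| Σ_i (F i - m²)`. -/
private theorem var_sum_eq {Ω ι : Type*} [MeasurableSpace Ω] {μ : Measure Ω}
    [IsProbabilityMeasure μ] [Fintype ι] [AddGroup ι] (B : ι → Ω → ℝ)
    (hBm : ∀ i, Measurable (B i)) {M : ℝ} (hM : ∀ i ω, |B i ω| ≤ M) {m : ℝ}
    (hm : ∀ i, ∫ ω, B i ω ∂μ = m) (F : ι → ℝ)
    (hF : ∀ i j, ∫ ω, B i ω * B j ω ∂μ = F (j - i)) :
    ∫ ω, ((∑ i, B i ω) - ∫ ω', ∑ i, B i ω' ∂μ) ^ 2 ∂μ =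
      (Fintype.card ι : ℝ) * ∑ i, (F i - m * m) := by
  have h2 : ∀ i, MemLp (B i) 2 μ := fun i =>
    MemLp.of_bound (hBm i).aestronglyMeasurable M
      (ae_of_all _ fun ω => by rw [Real.norm_eq_abs]; exact hM i ω)
  have hint : ∀ i, Integrable (B i) μ := fun i => (h2 i).integrable one_le_two
  have hint2 : ∀ i j, Integrable (fun ω => B i ω * B j ω) μ := fun i j =>
    (h2 i).integrable_mul (h2 j)
  have hS : MemLp (fun ω => ∑ i, B i ω) 2 μ := memLp_finsetSum _ fun i _ => h2 i
  have hmean : ∫ ω, ∑ i, B i ω ∂μ = (Fintype.card ι : ℝ) * m := by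
    rw [integral_finsetSum _ fun i _ => hint i]
    simp only [hm, Finset.sum_const, Finset.card_univ, nsmul_eq_mul]
  have hsq : ∫ ω, (∑ i, B i ω) ^ 2 ∂μ = (Fintype.card ι : ℝ) * ∑ i, F i := by
    calc ∫ ω, (∑ i, B i ω) ^ 2 ∂μ = ∫ ω, ∑ i, ∑ j, B i ω * B j ω ∂μ := by
          simp_rw [sq, Finset.sum_mul_sum]
      _ = ∑ i, ∑ j, ∫ ω, B i ω * B j ω ∂μ := by
          rw [integral_finsetSum _ fun i _ => integrable_finsetSum _ fun j _ => hint2 i j]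
          exact Finset.sum_congr rfl fun i _ => integral_finsetSum _ fun j _ => hint2 i j
      _ = ∑ i, ∑ j, F (j - i) := by simp_rw [hF]
      _ = ∑ _i : ι, ∑ j, F j :=
          Finset.sum_congr rfl fun i _ => Fintype.sum_equiv (Equiv.subRight i) _ _ fun _ => rfl
      _ = (Fintype.card ι : ℝ) * ∑ i, F i := by
          rw [Finset.sum_const, Finset.card_univ, nsmul_eq_mul]
  rw [integral_sub_average_sq hS, hsq, hmean, Finset.sum_sub_distrib, Finset.sum_const,
    Finset.card_univ, nsmul_eq_mul]
  ring

/-! ### Re-indexing of the Dirichlet form of a translate sum -/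

/-- The map `e ↦ ê = (e.1 - x₁(e) e₁, e.2)` is `(2S+1)`-to-one from the time-zero spatial links
onto those of the layer `x₁ = 0`, so for `Φ ≥ 0`, `Σ_{e slice} Φ ê ≤ (2S+1) Σ_{e slice} Φ e` (the
right side also counts the slice links off the layer). -/
private theorem sum_slice_shift_le {S : ℕ} (Φ : Edge 4 (2 * S + 1) → ℝ) (hΦ : ∀ e, 0 ≤ Φ e) :
    ∑ e : Edge 4 (2 * S + 1),
        (if e.1 0 = 0 ∧ e.2 ≠ 0 then Φ (e.1 + Pi.single (1 : Fin 4) (-(e.1 1)), e.2) else 0) ≤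
      (Fintype.card (ZMod (2 * S + 1)) : ℝ) *
        ∑ e : Edge 4 (2 * S + 1), (if e.1 0 = 0 ∧ e.2 ≠ 0 then Φ e else 0) := by
  have h01 : (0 : Fin 4) ≠ 1 := by decide
  -- insert the fibre variable `y = x₁(e)`
  have h1 : ∀ e : Edge 4 (2 * S + 1),
      (if e.1 0 = 0 ∧ e.2 ≠ 0 then Φ (e.1 + Pi.single (1 : Fin 4) (-(e.1 1)), e.2)
        else (0 : ℝ)) =
        ∑ y : ZMod (2 * S + 1), (if e.1 1 = y then
          (if e.1 0 = 0 ∧ e.2 ≠ 0 then Φ (e.1 + Pi.single (1 : Fin 4) (-y), e.2) else 0)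
          else 0) :=
    fun e => by simp only [Finset.sum_ite_eq, Finset.mem_univ, if_true]
  -- each fibre is a translate of the layer `x₁ = 0`
  have h2 : ∀ y : ZMod (2 * S + 1),
      ∑ e : Edge 4 (2 * S + 1), (if e.1 1 = y then
          (if e.1 0 = 0 ∧ e.2 ≠ 0 then Φ (e.1 + Pi.single (1 : Fin 4) (-y), e.2) else (0 : ℝ))
          else 0) =
        ∑ e : Edge 4 (2 * S + 1),
          (if e.1 1 = 0 then (if e.1 0 = 0 ∧ e.2 ≠ 0 then Φ e else 0) else 0) := fun y => by
    refine Fintype.sum_equiv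
      (torusEdgeShift (Pi.single (1 : Fin 4) (-y) : Site 4 (2 * S + 1))) _ _ fun e => ?_
    simp only [torusEdgeShift_apply, Pi.add_apply, Pi.single_eq_same, Pi.single_eq_of_ne h01,
      add_zero, add_neg_eq_zero]
  calc ∑ e : Edge 4 (2 * S + 1),
        (if e.1 0 = 0 ∧ e.2 ≠ 0 then Φ (e.1 + Pi.single (1 : Fin 4) (-(e.1 1)), e.2)
          else (0 : ℝ))
      = ∑ y : ZMod (2 * S + 1), ∑ e : Edge 4 (2 * S + 1), (if e.1 1 = y then
          (if e.1 0 = 0 ∧ e.2 ≠ 0 then Φ (e.1 + Pi.single (1 : Fin 4) (-y), e.2) else (0 : ℝ))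
          else 0) := by
        rw [Finset.sum_congr rfl fun e _ => h1 e, Finset.sum_comm]
    _ = (Fintype.card (ZMod (2 * S + 1)) : ℝ) * ∑ e : Edge 4 (2 * S + 1),
          (if e.1 1 = 0 then (if e.1 0 = 0 ∧ e.2 ≠ 0 then Φ e else 0) else 0) := by
        rw [Finset.sum_congr rfl fun y _ => h2 y, Finset.sum_const, Finset.card_univ,
          nsmul_eq_mul]
    _ ≤ _ := by
        refine mul_le_mul_of_nonneg_left (Finset.sum_le_sum fun e _ => ?_) (Nat.cast_nonneg _)
        split_ifs <;> first | exact le_rfl | exact hΦ _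

/-! ### Each link is read by exactly one translate -/

/-- Updating the link `e` changes the translate sum `Σ_y A ∘ T_y` of a layer observable `A` only
through the term `y₀ = -x₁(e)`, and there through the layer link `ê = (e.1 + y₀ e₁, e.2)`:
`f (update U e g) - f U = A (update (T_{y₀} U) ê g) - A (T_{y₀} U)`. -/
private theorem translateSum_update_sub {G : Type*} [MeasurableSpace G] {S : ℕ}
    {A : GaugeConfig 4 (2 * S + 1) G → ℝ}
    (hAd : DependsOn A {e : Edge 4 (2 * S + 1) | e.1 0 = 0 ∧ e.1 1 = 0 ∧ e.2 ≠ 0})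
    (e : Edge 4 (2 * S + 1)) (U : GaugeConfig 4 (2 * S + 1) G) (g : G) :
    (∑ y : ZMod (2 * S + 1),
        A (torusConfigShift (Pi.single (1 : Fin 4) y : Site 4 (2 * S + 1))
          (Function.update U e g))) -
        ∑ y : ZMod (2 * S + 1),
          A (torusConfigShift (Pi.single (1 : Fin 4) y : Site 4 (2 * S + 1)) U) =
      A (Function.update
          (torusConfigShift (Pi.single (1 : Fin 4) (-(e.1 1)) : Site 4 (2 * S + 1)) U)
          (e.1 + Pi.single (1 : Fin 4) (-(e.1 1)), e.2) g) -
        A (torusConfigShift (Pi.single (1 : Fin 4) (-(e.1 1)) : Site 4 (2 * S + 1)) U) := by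
  rw [← Finset.sum_sub_distrib, Finset.sum_eq_single (-(e.1 1))]
  · rw [shift_update]
  · intro y _ hy
    rw [sub_eq_zero]
    refine hAd fun e' he' => ?_
    simp only [Set.mem_setOf_eq] at he'
    rw [torusConfigShift_apply, torusConfigShift_apply, Function.update_of_ne]
    intro h
    apply hy
    have h1 := congrArg (fun e'' : Edge 4 (2 * S + 1) => e''.1 1) h
    simp only [Pi.sub_apply, Pi.single_eq_same, he'.2.1, zero_sub] at h1
    rw [← h1, neg_neg]
  · intro h
    exact absurd (Finset.mem_univ _) h

/-! ### The main lemma: an arbitrary translation-invariant probability measure -/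

/-- **Main lemma.**  Let `μ` be a probability measure on `GaugeConfig 4 (2S+1) G` invariant under
the translations `T_y` in direction `1`, `Λ U V` a translation-invariant gauge of the distance of
two configurations, and `sl f U e` a functional of `(f, U, e)` depending only on the difference
function `g ↦ f (update U e g) - f U` and on `U e`.  If every gauge-invariant `Λ`-Lipschitz `f`
reading only time-zero spatial links satisfies `Var_μ f ≤ κ Σ_{e slice} ∫ (sl f U e)² dμ`
(`0 ≤ κ`), then every bounded measurable gauge-invariant `Λ`-Lipschitz `A` reading only the
spatial links of the layer `{t = 0, x₁ = 0}` satisfies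
`Σ_y Cov_μ(A, A ∘ T_y) ≤ κ Σ_{e slice} ∫ (sl A U e)² dμ`. -/
private theorem sliceCovSum_le_of_poincare {G : Type*} [Group G] [MeasurableSpace G] {S : ℕ}
    (μ : Measure (GaugeConfig 4 (2 * S + 1) G)) [IsProbabilityMeasure μ]
    (hμ : ∀ y : ZMod (2 * S + 1),
      μ.map (torusConfigShift (Pi.single (1 : Fin 4) y : Site 4 (2 * S + 1))) = μ)
    (Λ : GaugeConfig 4 (2 * S + 1) G → GaugeConfig 4 (2 * S + 1) G → ℝ)
    (hΛ : ∀ (y : ZMod (2 * S + 1)) (U V : GaugeConfig 4 (2 * S + 1) G),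
      Λ (torusConfigShift (Pi.single (1 : Fin 4) y : Site 4 (2 * S + 1)) U)
        (torusConfigShift (Pi.single (1 : Fin 4) y : Site 4 (2 * S + 1)) V) = Λ U V)
    (sl : (GaugeConfig 4 (2 * S + 1) G → ℝ) → GaugeConfig 4 (2 * S + 1) G →
      Edge 4 (2 * S + 1) → ℝ)
    (hsl : ∀ (f f' : GaugeConfig 4 (2 * S + 1) G → ℝ) (U U' : GaugeConfig 4 (2 * S + 1) G)
      (e e' : Edge 4 (2 * S + 1)),
      (∀ g, f (Function.update U e g) - f U = f' (Function.update U' e' g) - f' U') →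
      U e = U' e' → sl f U e = sl f' U' e')
    (κ : ℝ) (hκ : 0 ≤ κ)
    (hP : ∀ f : GaugeConfig 4 (2 * S + 1) G → ℝ, IsGaugeInvariant f →
      (∀ U V : GaugeConfig 4 (2 * S + 1) G,
        (∀ e : Edge 4 (2 * S + 1), e.1 0 = 0 → e.2 ≠ 0 → U e = V e) → f U = f V) →
      (∃ K : ℝ, ∀ U V : GaugeConfig 4 (2 * S + 1) G, |f U - f V| ≤ K * Λ U V) →
      ∫ U, (f U - ∫ V, f V ∂μ) ^ 2 ∂μ ≤
        κ * ∑ e : Edge 4 (2 * S + 1),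
          (if e.1 0 = 0 ∧ e.2 ≠ 0 then ∫ U, (sl f U e) ^ 2 ∂μ else 0))
    (A : GaugeConfig 4 (2 * S + 1) G → ℝ) (hAm : Measurable A) (hAb : ∃ M : ℝ, ∀ U, |A U| ≤ M)
    (hAg : IsGaugeInvariant A)
    (hAd : DependsOn A {e : Edge 4 (2 * S + 1) | e.1 0 = 0 ∧ e.1 1 = 0 ∧ e.2 ≠ 0})
    (hAl : ∃ K : ℝ, ∀ U V : GaugeConfig 4 (2 * S + 1) G, |A U - A V| ≤ K * Λ U V) :
    ∑ y : ZMod (2 * S + 1),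
        (∫ U, A U * A (torusConfigShift (Pi.single (1 : Fin 4) y : Site 4 (2 * S + 1)) U) ∂μ -
          (∫ U, A U ∂μ) * ∫ U, A U ∂μ) ≤
      κ * ∑ e : Edge 4 (2 * S + 1),
        (if e.1 0 = 0 ∧ e.2 ≠ 0 then ∫ U, (sl A U e) ^ 2 ∂μ else 0) := by
  obtain ⟨M, hM⟩ := hAb
  obtain ⟨K, hK⟩ := hAl
  -- change of variables under the translations
  have hInv : ∀ (y : ZMod (2 * S + 1)) (F : GaugeConfig 4 (2 * S + 1) G → ℝ),
      ∫ U, F (torusConfigShift (Pi.single (1 : Fin 4) y : Site 4 (2 * S + 1)) U) ∂μ =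
        ∫ U, F U ∂μ := fun y F => by
    rw [← integral_map_equiv, hμ y]
  -- the translate sum
  obtain ⟨f, hf⟩ : ∃ f : GaugeConfig 4 (2 * S + 1) G → ℝ, f = fun U =>
      ∑ y : ZMod (2 * S + 1),
        A (torusConfigShift (Pi.single (1 : Fin 4) y : Site 4 (2 * S + 1)) U) := ⟨_, rfl⟩
  -- (a) it is gauge invariant
  have hfg : IsGaugeInvariant f := fun g U => by
    simp only [hf, shift_gaugeTransform]
    exact Finset.sum_congr rfl fun y _ => hAg _ _
  -- (b) it reads only time-zero spatial links
  have hfd : ∀ U V : GaugeConfig 4 (2 * S + 1) G,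
      (∀ e : Edge 4 (2 * S + 1), e.1 0 = 0 → e.2 ≠ 0 → U e = V e) → f U = f V := by
    intro U V hUV
    simp only [hf]
    refine Finset.sum_congr rfl fun y _ => hAd fun e' he' => ?_
    simp only [Set.mem_setOf_eq] at he'
    simp only [torusConfigShift_apply]
    refine hUV _ ?_ he'.2.2
    simp [he'.1]
  -- (c) it is Lipschitz
  have hfl : ∃ K' : ℝ, ∀ U V : GaugeConfig 4 (2 * S + 1) G, |f U - f V| ≤ K' * Λ U V := by
    refine ⟨(Fintype.card (ZMod (2 * S + 1)) : ℝ) * K, fun U V => ?_⟩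
    simp only [hf]
    rw [← Finset.sum_sub_distrib]
    refine (Finset.abs_sum_le_sum_abs _ _).trans ?_
    calc ∑ y : ZMod (2 * S + 1),
          |A (torusConfigShift (Pi.single (1 : Fin 4) y : Site 4 (2 * S + 1)) U) -
            A (torusConfigShift (Pi.single (1 : Fin 4) y : Site 4 (2 * S + 1)) V)|
        ≤ ∑ _y : ZMod (2 * S + 1), K * Λ U V :=
          Finset.sum_le_sum fun y _ => (hK _ _).trans_eq (by rw [hΛ])
      _ = (Fintype.card (ZMod (2 * S + 1)) : ℝ) * K * Λ U V := by
          rw [Finset.sum_const, Finset.card_univ, nsmul_eq_mul, mul_assoc]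
  -- the Poincaré inequality for `f`
  have hPf := hP f hfg hfd hfl
  -- VARIANCE of the translate sum
  have hvar : ∫ U, (f U - ∫ V, f V ∂μ) ^ 2 ∂μ = (Fintype.card (ZMod (2 * S + 1)) : ℝ) *
      ∑ y : ZMod (2 * S + 1),
        (∫ U, A U * A (torusConfigShift (Pi.single (1 : Fin 4) y : Site 4 (2 * S + 1)) U) ∂μ -
          (∫ U, A U ∂μ) * ∫ U, A U ∂μ) := by
    simp only [hf]
    refine var_sum_eq (μ := μ)
      (fun (y : ZMod (2 * S + 1)) U =>
        A (torusConfigShift (Pi.single (1 : Fin 4) y : Site 4 (2 * S + 1)) U))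
      (fun y => hAm.comp (torusConfigShift _).measurable) (fun y U => hM _) (fun y => hInv y A)
      (fun z => ∫ U, A U * A (torusConfigShift (Pi.single (1 : Fin 4) z : Site 4 (2 * S + 1)) U) ∂μ)
      fun y y' => ?_
    -- `∫ A(T_y U) A(T_{y'} U) dμ = ∫ A U · A (T_{y'-y} U) dμ`
    refine Eq.trans ?_ (hInv y fun V =>
      A V * A (torusConfigShift (Pi.single (1 : Fin 4) (y' - y) : Site 4 (2 * S + 1)) V))
    congr 1
    funext U
    rw [shift_shift, ← Pi.single_add, sub_add_cancel]
  -- DIRICHLET FORM of the translate sum, link by link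
  have hterm : ∀ e : Edge 4 (2 * S + 1), ∫ U, (sl f U e) ^ 2 ∂μ =
      ∫ U, (sl A U (e.1 + Pi.single (1 : Fin 4) (-(e.1 1)), e.2)) ^ 2 ∂μ := fun e => by
    have h1 : ∀ U, sl f U e =
        sl A (torusConfigShift (Pi.single (1 : Fin 4) (-(e.1 1)) : Site 4 (2 * S + 1)) U)
          (e.1 + Pi.single (1 : Fin 4) (-(e.1 1)), e.2) := fun U =>
      hsl _ _ _ _ _ _ (fun g => by simpa only [hf] using translateSum_update_sub hAd e U g)
        (by simp [torusConfigShift_apply])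
    simp_rw [h1]
    exact hInv (-(e.1 1)) fun V => (sl A V (e.1 + Pi.single (1 : Fin 4) (-(e.1 1)), e.2)) ^ 2
  have hdir : ∑ e : Edge 4 (2 * S + 1),
        (if e.1 0 = 0 ∧ e.2 ≠ 0 then ∫ U, (sl f U e) ^ 2 ∂μ else 0) ≤
      (Fintype.card (ZMod (2 * S + 1)) : ℝ) * ∑ e : Edge 4 (2 * S + 1),
        (if e.1 0 = 0 ∧ e.2 ≠ 0 then ∫ U, (sl A U e) ^ 2 ∂μ else 0) := by
    simp_rw [hterm]
    exact sum_slice_shift_le (fun e => ∫ U, (sl A U e) ^ 2 ∂μ)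
      fun e => integral_nonneg fun U => sq_nonneg _
  -- conclusion: `(2S+1) · LHS = Var f ≤ κ dir f ≤ κ (2S+1) dir A`
  have hL : (0 : ℝ) < Fintype.card (ZMod (2 * S + 1)) := Nat.cast_pos.2 Fintype.card_pos
  refine le_of_mul_le_mul_left ?_ hL
  rw [← hvar]
  exact hPf.trans ((mul_le_mul_of_nonneg_left hdir hκ).trans_eq (mul_left_comm _ _ _))

/-! ### The registered stub -/

/-- **F1 `stub_sliceCovSum_le`** (crux `ConvexGribovBody.PoincareToGap`, line `Sketch`): on one
torus `(2S+1)⁴`, IF the crux hypothesis — the time-zero slice Poincaré inequality with constant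
`κ ≥ 0` for gauge-invariant link-Lipschitz functions of the time-zero spatial links — holds at
this `S`, then for every bounded measurable gauge-invariant link-Lipschitz observable `A` reading
only time-zero spatial links based in the layer `x₁ = 0`, the susceptibility in direction `1` is
bounded by the Dirichlet form: `Σ_{y ∈ ℤ/(2S+1)} Cov_μ(A, A ∘ T_y) ≤ κ · dir A`.  Instance of
`sliceCovSum_le_of_poincare` with `μ = wilsonMeasure r.ρ β` (`wilsonMeasure_map_torusConfigShift`),
the Frobenius Lipschitz gauge and the metric slope. -/
theorem stub_sliceCovSum_le :
    ∀ (G : Type) [Group G] [TopologicalSpace G] [IsTopologicalGroup G] [CompactSpace G]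
      [MeasurableSpace G] [BorelSpace G] (r : LatticeRep G) (β κ : ℝ), 0 ≤ κ → ∀ S : ℕ,
    (∀ f : GaugeConfig 4 (2 * S + 1) G → ℝ, IsGaugeInvariant f →
      (∀ U V : GaugeConfig 4 (2 * S + 1) G,
        (∀ e : Edge 4 (2 * S + 1), e.1 0 = 0 → e.2 ≠ 0 → U e = V e) → f U = f V) →
      (∃ K : ℝ, ∀ U V : GaugeConfig 4 (2 * S + 1) G,
        |f U - f V| ≤ K * ∑ e, Real.sqrt (∑ a, ∑ b, ‖(r.ρ (U e) - r.ρ (V e)) a b‖ ^ 2)) →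
      ∫ U, (f U - ∫ V, f V ∂(wilsonMeasure r.ρ β : Measure (GaugeConfig 4 (2 * S + 1) G))) ^ 2
          ∂(wilsonMeasure r.ρ β : Measure (GaugeConfig 4 (2 * S + 1) G)) ≤
        κ * ∑ e : Edge 4 (2 * S + 1), (if e.1 0 = 0 ∧ e.2 ≠ 0 then
          ∫ U, (Filter.limsup (fun g : G => |f (Function.update U e g) - f U| /
              Real.sqrt (∑ a, ∑ b, ‖(r.ρ g - r.ρ (U e)) a b‖ ^ 2)) (𝓝[≠] (U e))) ^ 2
            ∂(wilsonMeasure r.ρ β : Measure (GaugeConfig 4 (2 * S + 1) G)) else 0)) →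
    ∀ μ : Measure (GaugeConfig 4 (2 * S + 1) G),
      μ = (wilsonMeasure r.ρ β : Measure (GaugeConfig 4 (2 * S + 1) G)) →
    ∀ A : GaugeConfig 4 (2 * S + 1) G → ℝ, Measurable A → (∃ M : ℝ, ∀ U, |A U| ≤ M) →
      IsGaugeInvariant A →
      DependsOn A {e : Edge 4 (2 * S + 1) | e.1 0 = 0 ∧ e.1 1 = 0 ∧ e.2 ≠ 0} →
      (∃ K : ℝ, ∀ U V : GaugeConfig 4 (2 * S + 1) G,
        |A U - A V| ≤ K * ∑ e, Real.sqrt (∑ a, ∑ b, ‖(r.ρ (U e) - r.ρ (V e)) a b‖ ^ 2)) →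
    ∑ y : ZMod (2 * S + 1),
        (∫ U, A U * A (torusConfigShift (Pi.single (1 : Fin 4) y : Site 4 (2 * S + 1)) U) ∂μ -
          (∫ U, A U ∂μ) * ∫ U, A U ∂μ) ≤
      κ * ∑ e : Edge 4 (2 * S + 1), (if e.1 0 = 0 ∧ e.2 ≠ 0 then
          ∫ U, (Filter.limsup (fun g : G => |A (Function.update U e g) - A U| /
              Real.sqrt (∑ a, ∑ b, ‖(r.ρ g - r.ρ (U e)) a b‖ ^ 2)) (𝓝[≠] (U e))) ^ 2 ∂μ
          else 0) := by
  intro G _ _ _ _ _ _ r β κ hκ S hP μ hμ A hAm hAb hAg hAd hAl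
  subst hμ
  haveI := isProbabilityMeasure_wilsonMeasure (d := 4) (L := 2 * S + 1) r.ρ r.continuous β
  exact sliceCovSum_le_of_poincare (S := S) (wilsonMeasure r.ρ β)
    (fun y => wilsonMeasure_map_torusConfigShift r.ρ β _)
    (fun U V => ∑ e, Real.sqrt (∑ a, ∑ b, ‖(r.ρ (U e) - r.ρ (V e)) a b‖ ^ 2))
    (fun y U V => Fintype.sum_equiv
      (torusEdgeShift (Pi.single (1 : Fin 4) y : Site 4 (2 * S + 1))).symm _ _ fun e => by
        simp only [torusConfigShift_apply, torusEdgeShift_symm_apply])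
    (fun f U e => Filter.limsup (fun g : G => |f (Function.update U e g) - f U| /
      Real.sqrt (∑ a, ∑ b, ‖(r.ρ g - r.ρ (U e)) a b‖ ^ 2)) (𝓝[≠] (U e)))
    (fun f f' U U' e e' h1 h2 => by simp only [h1, h2]) κ hκ hP A hAm hAb hAg hAd hAl

end Summit.QuantumFields.YangMills.Theorems.PoincareToGap

end
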